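import Literature.AlgebraicGeometry.ShimuraVarieties.RapoportSmithlingZhang2020.Sec5GlobalIntegralModels   -- ★ t04: `hermForm`, `InDual`, `IsNormAt`, `hermIsSplitAt` (Notation (1.4)); brings ★ `Sec3IntegralModels`, ★ `Sec2GroupTheoreticSetup`, ★ `Liu2021.AppendixC.HermSpace`, `conj`
import Mathlib.RingTheory.Length                                                                         -- `Module.length` («finite colength», p. 6)
import HarnessLib

/-!
# [RapoportSmithlingZhang2020Diagonal] §1 «Introduction» (arXiv v6 pp. 1–7) — INDEX file of the squad-TKR carpet, and the three
# Notation rows of pp. 6–7 that no squad file had typed («`M ⊂^r N`», «`Λ^∨`» as a submodule, «`−W`»)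

M. Rapoport, B. Smithling, W. Zhang, *Arithmetic diagonal cycles on unitary Shimura varieties*, Compositio Math. **156** (2020)
1745–1824 = arXiv:1710.06962 **v6**.  PRIMARY SOURCE READ FOR THIS FILE: the v6 per-page text of record
`run/shared/lean/pub/hodgecm-mathlib/F0/P6/lit1/RSZ2020-v6-pages.txt` (pp. 2–7; «p. N» below = arXiv v6 page, the house form of the 313 tree
tags; the Compositio offset is not held and no journal page is claimed) with the lit1 kit `RSZ2020-v6-itemmap.lit1-g5.md` (sha16 15cc0883).
§1 = pp. 1–7: the three aims (pp. 1–2), the data `F/F₀, Φ, φ₀, r, E, Z^ℚ, W, G, G̃` and display **(1.1)** (p. 2), the sign invariant, the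
integral models, `u`, `W♭`, `H̃`, display **(1.2)**, `z_{K_{H̃G}}`, `z_{K,0}`, `ℓ_K` (p. 3), **Conjecture 1.1** (semi-global; pp. 3–4), **Theorem 1.2**,
**Theorem 1.3** (p. 4), perspective and layout (pp. 4–5), **Notation** (pp. 5–7) with displays **(1.3)** (p. 5), **(1.4)**, **(1.5)** (p. 6) and the
lattice terminology (p. 7, footnote 5).

House precedent for an introduction INDEX: ★ `Literature/NumberTheory/Automorphic/Liu2021/Sec1Introduction.lean` (squad TL).  Squad TKR deal
TKR-plan 2026-09-02T03:04:30Z (row moved from TKR-t03 to TKR-t01): «INDEX file: `def`-free where the item is already ★ — cite the landed decl by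
FQN in a doc-comment table; type ONLY notation rows nobody landed».

## What this file is

§1 is an introduction.  Conjecture 1.1 and Theorems 1.2, 1.3 are the announced forms of Conjecture 8.13, Theorems 8.15 + 8.19 and
Proposition 8.12, typed (as predicates on the §8 datum) in ★ `Sec8ArithmeticIntersectionPairing.lean`; the data of pp. 2–3 are the objects of
§§2–6, typed in ★ `Sec2GroupTheoreticSetup`, ★ `Sec3IntegralModels`, ★ `Sec4CitedRows`, ★ `Sec5GlobalIntegralModels`, ★ `AppASignInvariants` and ★
`Sec6ArithmeticIntersectionConjecture`; the Notation facts of p. 6 (Hasse principle, product formula (1.5), Landherr's theorem) are THEOREMS of the tree's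
`Literature/NumberTheory/QuadraticForms/`.  All of these are INDEXED below to their declarations and NOT re-typed (squad rule R-9 (2):
dedup-by-content, cite by name).  What no file had typed are three purely notational rows of pp. 6–7, typed here as REAL definitions with
bodies (no carrier, no named fact, nothing asserted ⇒ net debt 0):

1. `IsOfColength M N r` — «Given modules `M` and `N` over a ring `R`, we write `M ⊂^r N` to indicate that `M` is an `R`-submodule of `N` of
   finite colength `r`» (p. 6): `M ≤ N` and `length_R (N/M) = r` (Mathlib `Module.length`, `Submodule.submoduleOf`).
2. `dualLattice J Λ` — «When `Λ` is an `O_F`-lattice in an `F/F₀`-hermitian space, we denote the dual lattice with respect to the hermitian form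
   by `Λ^∨`» (pp. 6–7): the `O_F`-SUBMODULE `{x ∣ (x, y) ∈ O_F for all y ∈ Λ}` of the coordinate space `κ → F` with Gram matrix `J`, whose
   membership predicate is, by `Iff.rfl`, TKR-t04's ★ `Sec5GlobalIntegralModels.InDual F₀ F J Λ x` (the form = ★ `Sec5GlobalIntegralModels.hermForm`,
   `F`-linear in the first variable, p. 6).  So «`Λ ⊂ Λ^∨`» is `Λ ≤ dualLattice F₀ F J Λ` and «`Λ ⊂^r Λ^∨`» is `IsOfColength Λ (dualLattice F₀ F J Λ) r`.
3. `negHermSpace W` — «We also write `−W` for the same `A`-module as `W`, but with the hermitian form multiplied by `−1`. Of course `W` and `−W`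
   have the same unitary groups» (p. 6), on ★ `Liu2021.AppendixC.HermSpace F₀ F` (same `V`, same `n`, form `−( , )`); it is the `−W` of (3.12)
   «`η : V̂(A₀, A) ≃ −W ⊗_F 𝔸_{F,f}`» (recorded in ★ `Sec3IntegralModels`) and of «`inv_v(−W_v)`» in the sign conditions (4.4) ∕ (5.3) (★
   `Sec4CitedRows.Sec4Data.SignCond`, ★ `Sec5GlobalIntegralModels.Sec5Data.Tuple.SignCond`).

NO proof of any statement, no `instance`, no notation, no named fact; the three definitions carry only their own well-definedness obligations.

## INDEX — every item of §1 (pp. 1–7) ↦ its tree declaration(s)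

(Namespaces: `R` = `Literature.AlgebraicGeometry.ShimuraVarieties.RapoportSmithlingZhang2020`, `KR` = `Literature.AlgebraicGeometry.ShimuraVarieties.
KudlaRapoport2013`, `Q` = `Literature.NumberTheory.QuadraticForms`, `LC` = `Literature.NumberTheory.Automorphic.Liu2021.AppendixC`,
`L` = `Literature.NumberTheory.Automorphic.Liu2021`, `AS` = `Literature.AlgebraicGeometry.AbelianSchemes`; «(TKR-t0k, HOME)» = prepared in the
named squad seat's folder at the squad home `run/shared/lean/pub/hodgecm-mathlib/T/KR/`, not yet ★ — cited by file and typer; ★ files other than the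
one imported are cited by FQN in this docstring only, an INDEX importing nothing it does not use.)

### The three aims and the data (pp. 1–3)
* «`F` a CM number field, `F₀` its maximal totally real subfield», «a CM type `Φ` of `F` and a distinguished element `φ₀ ∈ Φ`», «`n ≥ 2`» (p. 2)
  ↦ ★ `R.Sec3IntegralModels.ShimuraDatum` (fields `Φ : ★ Literature.AlgebraicGeometry.Motives.CMType F`, `φ₀`, `φ₀_mem`, `W`, `two_le_n`), over the
  instance context `[IsTotallyReal F₀] [IsTotallyComplex F] [Algebra.IsQuadraticExtension F₀ F]` used by every squad file; «`a ↦ ā`» ↦ ★ `LC.conj F₀ F`,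
  ★ `R.Sec2GroupTheoreticSetup.cbar`.
* «`r : Hom(F, ℂ) → {0, 1, n−1, n}`, `r_φ := 1 (φ = φ₀); 0 (φ ∈ Φ ∖ {φ₀}); n − r_φ̄ (φ ∉ Φ)`» (p. 2, unnumbered display = (3.14) of Remark 3.6 (i))
  ↦ ★ `R.Sec3IntegralModels.ShimuraDatum.signatureFn`; «generalized CM type of rank `n`» ↦ ★ `R.AppASignInvariants.IsGeneralizedCMType`.
* «the field `E ⊂ ℚ̄`, the composite of the reflex field of `r` and the reflex field of `Φ`. Then `E` contains `F` via `φ₀`» (p. 2) ↦ ★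
  `R.Sec3IntegralModels.reflexFieldOf Φ φ₀` (= `E_Φ · φ₀(F)`, Remark 3.1, with (3.1) = ★ `Literature.NumberTheory.ComplexMultiplication.
  CMTypeDistinguishedElementReflexField.eq_traceField_sup_fieldRange_iff_forall`), ★ `R.Sec3IntegralModels.phi0ToReflexFieldOf` («contains `F` via
  `φ₀`»), ★ `R.AppASignInvariants.reflexFieldJoin Φ r` (the App. A form (A.4)).
* «`Z^ℚ := {z ∈ Res_{F/ℚ} 𝔾_m ∣ Nm_{F/F₀}(z) ∈ 𝔾_m}`» (p. 2) ↦ ★ `R.Sec2GroupTheoreticSetup.Sec2Datum.ZQ` (points in ℚ-algebras `R`).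
* «an `F/F₀`-hermitian vector space `W` of dimension `n` with `sig(W_φ) = (r_φ, r_φ̄)`, `φ ∈ Φ`» (p. 2) ↦ ★ `R.Sec3IntegralModels.ShimuraDatum.W`
  (★ `LC.HermSpace F₀ F`) with the signature hypotheses `ShimuraDatum.sig_φ₀` («`(1, n−1)` at `φ₀`») and `ShimuraDatum.sig_of_ne` («`(0, n)`
  elsewhere») — NB the main body's convention (§3.1 p. 8, Remark 3.6 (ii)) which the intro's footnote 2 flags as differing from p. 2.
* «`G` the unitary group of `W`, as an algebraic group over `ℚ`» (footnote 2: in the body `G = U(W)` over `F₀`), «`G̃ := Z^ℚ × G`», «`K_G̃ = K_{Z^ℚ} ×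
  K_G`» (p. 2) ↦ ★ `R.Sec2GroupTheoreticSetup.Sec2Datum.Gpts` ∕ `GQ` ∕ `Gtilde` ∕ `Htilde` ∕ `HGtilde` (§2.1 p. 7) with the product decomposition
  (2.1) ★ `Sec2Datum.Eq21_productDecomposition` and the embeddings (2.2) ★ `Sec2Datum.Eq22_embeddings`; `K_{Z^ℚ}` «the unique maximal compact
  subgroup of `Z^ℚ(𝔸_f)`» = (3.7) ↦ ★ `R.Sec3IntegralModels.Sec3Data` level carriers (`IsLevel`); «central isogeny to `GU(W)`», Kottwitz [29],
  Harris–Taylor [19] (pp. 2–3) — context, not typed (Remark 3.1's Harris–Taylor sentence ↦ ★ `R.Sec3IntegralModels.Sec3Data.Rem31_harrisTaylor`).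
* **(1.1)** «`Sh_{K_G̃}(G̃) = M_{K_G̃}(G̃) ⊗_E ℂ`», «a PEL moduli problem `M_{K_G̃}(G̃)` of abelian varieties with additional structure … which defines
  a model over `E`» (p. 2) ↦ ★ `R.Sec3IntegralModels.Sec3Data.Prop37` (Proposition 3.7 p. 13: the coarse moduli scheme of `M_{K_G̃}(G̃)` is
  quasi-projective over `E` and isomorphic to the canonical model `ShG K`), the moduli objects ↦ ★ `R.Sec3IntegralModels.M0Obj` ∕ `Sec3Data` (§3.2).
* «a sign invariant `inv^r_v(A₀, A) ∈ {±1}` for every non-archimedean place `v` of `F₀` which is non-split in `F`» (p. 3) ↦ ★ `R.AppASignInvariants.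
  InvIsOne` ∕ `sgn` ∕ `AdjustedInvIsOne` ((A.1)–(A.8)); Proposition A.1 ↦ the `R.AppASignInvariants` ED. 2 (TKR-t05, HOME; ★ ED. 1 types (A.1)–(A.11) and Remark A.2).
* «global integral models of `M_{K_G̃}(G̃)` over `Spec O_E` (at least when `F/F₀` is not everywhere unramified) and semi-global integral models over
  `Spec O_{E,(ν)}`» (p. 3) ↦ ★ `R.Sec5GlobalIntegralModels.Sec5Data.Thm52` ∕ `Thm54` (Theorems 5.2, 5.4) and ★ `R.Sec4CitedRows.Sec4Data.Thm41` ∕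
  `Lemma43` ∕ `Thm45` (Theorems 4.1, 4.5); «the Pappas wedge condition, the spin condition …, the Eisenstein conditions» ↦ ★ `R.Sec4CitedRows.Sec4Data.
  EisensteinCond` (4.10), ★ `R.AppBLocalModelsBanalSignature.EisensteinCondition` ∕ `KottwitzCondition`; «vertex lattices in the sense of [30]» ↦ lattice
  rows of the Notation below.
* «fixing a totally negative vector `u ∈ W` … `W♭` the orthogonal complement of `u`», «`H̃ = Z^ℚ × H`, `H = U(W♭)`» (p. 3) ↦ ★ `R.Sec3IntegralModels.
  ShimuraDatum.u` ∕ `u_totallyNegative` (★ `LC.HermSpace.IsNegAt`), ★ `R.Sec2GroupTheoreticSetup.Sec2Datum.Wflat` ∕ `incl` ∕ `Hpts` ∕ `HQ` ∕ `Htilde`.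
* **(1.2)** «We obtain a finite unramified morphism `M_{K_H̃}(H̃) → M_{K_G̃}(G̃)`, resp. their global, resp. semi-global integral versions» (p. 3) = the
  functor morphism **(3.16)** (p. 14, «The morphism (3.16) is finite and unramified», p. 15) and its integral versions (4.3), (4.27)–(4.29), (5.5),
  (5.9)–(5.10).  RECORDED, NOT TYPED anywhere in the squad's files: ★ `R.Sec3IntegralModels` records (3.15)–(3.17) as not typed (no `H̃`-side moduli
  carrier; module docstring «NOT TYPED (recorded)»), ★ `R.Sec5GlobalIntegralModels` records (5.5), (5.9)–(5.11) likewise; no stack ∕ functor-morphism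
  vocabulary exists to state «finite unramified» on.  Not typed here either (an INDEX introduces no carrier).
* «the element `z_{K_{H̃G}} ∈ Ch^{n−1}(M_{K_{H̃G}}(H̃G))_ℚ`», «the Hecke–Künneth projector», «a cohomologically trivial variant `z_{K_{H̃G},0}`», «the
  linear form `ℓ_{K_{H̃G}}`», «the standard sign conjecture … a theorem of Morel–Suh [39, Th. 1.2], cf. Section 6.2» (pp. 2–3) ↦ ★
  `R.Sec6ArithmeticIntersectionConjecture.Sec6Data.zK` ((6.12)) ∕ `ZK` ∕ `zK0` ∕ `ZK0` ((6.13) ff.) ∕ `ellK` (the linear form) ∕ `IsHeckeKunnethProjector` ∕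
  `Thm66` (Theorem 6.6, the sign-conjecture input) with ★ `R.Sec6ArithmeticIntersectionConjecture.HeightSetting` ∕ `RSZ2020_6_1_model` ∕ `RSZ2020_6_2_surjective`
  (Conjectures 6.1 ∕ 6.2 as predicates, Beilinson–Bloch) and the §6 versions of the intersection conjecture: Conjecture 6.10 ↦ ★ `Sec6Data.RSZ2020_6_10`,
  Conjecture 6.12 and Remarks 6.3 ∕ 6.4 ↦ by item number only (their declarations are being reshaped by the §6 ED. 2 of TKR-t04, squad QA-R6-2; cite
  the ★ names once it lands); the arithmetic-Chow classes ↦ ★ `R.Sec8ArithmeticIntersectionPairing.Sec8Data.zK` ∕ `zHat` ((8.3) ff.).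
* «the Gillet–Soulé intersection product pairing on the rational arithmetic Chow group» (p. 3) ↦ ★ `R.Sec8ArithmeticIntersectionPairing.Sec8Data`
  ⟨CARRIER⟩ `gs` with (8.2) ★ `RSZ2020_8_Eq82_hermitian`.

### Conjecture 1.1, Theorems 1.2 and 1.3 (pp. 3–4) — announced forms of §8 items, NOT re-typed
* **Conjecture 1.1 (Semi-global conjecture)** (pp. 3–4) = **Conjecture 8.13** (p. 50; «We refer to the body of the text for an explanation of the terms
  used (cf. Conjecture 8.13)», p. 4) ↦ ★ `R.Sec8ArithmeticIntersectionPairing.Sec8Data.RSZ2020_8_13_i_statement` (part (i), hyperspecial type) and ★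
  `Sec8Data.RSZ2020_8_13_ii_statement` (part (ii), archimedean or AT type), both PREDICATES on the §8 datum asserted nowhere (squad rule R-7; the
  source's word «Conjecture» is the heading of an unproved prediction — it is vocabulary, not a Literature fact), with the common hypotheses ★
  `Sec8Data.SemiGlobalHyp` and the bare identity ★ `Sec8Data.RSZ2020_8_13_identity`.  Its terms: «`Int_{v₀}(f)`» ↦ ★ `Sec8Data.IntAt` ((8.15) ∕ (8.18) ∕
  (8.19)); «`J`, `∂J_{v₀}` … the distributions (cf. (7.9) and (7.10))» ↦ ★ `R.Sec7LFunctionsRTF.Sec7Data.J₀` ∕ `dJv`; «completely decomposed» ↦ ★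
  `Sec7Data.IsCompletelyDecomposed` ∕ `IsCompletelyDecomposedGlobal`; «Gaussian test function» ↦ ★ `Sec7Data.IsGaussian`; «smooth transfer» ↦ ★
  `Sec7Data.AreSmoothTransfers` ∕ ★ `Sec8Data.FinitePartSmoothTransfer`; «regular support at `ν` in the sense of Definition 8.4» ↦ ★
  `Sec8Data.HasRegularSupportU`; «in the sense of Definition 7.5» ↦ ★ `Sec7Data.HasRegularSupportAt`; «hyperspecial type, cf. Section 4.1» ↦ ★
  `Sec8Data.IsHyperspecialType`, ★ `R.Sec4CitedRows.HyperspecialHypotheses`; «AT type, cf. Section 4.4» ↦ ★ `Sec8Data.IsATType`, ★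
  `R.Sec5GlobalIntegralModels.Sec5Data.IsATType`; «`f′_corr[v₀]` … a correction function» ↦ the existential of `RSZ2020_8_13_ii_statement`;
  «`R(f)` the Hecke correspondence» ↦ ★ `Sec8Data.Rhat`.
* **Theorem 1.2** (p. 4) «Let `v₀` be a non-archimedean place of `F₀` that is non-split in `F`. Then Conjecture 1.1 above holds true for `n ≤ 3`.»
  ↦ the conjunction of ★ `R.Sec8ArithmeticIntersectionPairing.Sec8Data.RSZ2020_8_15_hyperspecial_n_le_3` (**Theorem 8.15** p. 51: 8.13 (i) for
  `n ≤ 3`) and ★ `Sec8Data.RSZ2020_8_19_AT_n_le_3` (**Theorem 8.19** p. 54: 8.13 (ii) for `n ≤ 3`, `v₀` non-archimedean) — Conjecture 1.1 makes a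
  claim at a non-archimedean non-split `v₀` only in the hyperspecial case (i) and the AT case (ii).  NOT re-typed.
* **Theorem 1.3** (p. 4) «Let `v₀` be a place of `F₀` that is split in `F`. Let `f` and `f′` be as in Conjecture 8.8. Then `Int_{v₀}(f) =
  ∂J_{v₀}(f′) = 0`.» = **Proposition 8.12** (p. 49; «cf. Proposition 8.12», p. 4) ↦ ★ `R.Sec8ArithmeticIntersectionPairing.Sec8Data.
  RSZ2020_8_12_split_vanishing`, with «`∂J_{v₀}(f′) = 0` at split `v₀`» = Lemma 7.12 ↦ ★ `R.Sec7LFunctionsRTF.Sec7Data.RSZ2020_7_12_dJv_vanishes_at_split`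
  and Conjecture 8.8's hypotheses ↦ ★ `Sec8Data.RSZ2020_8_8_statement`.  NOT re-typed.
* pp. 4–5 (perspective: Gross's question, Kisin–Pappas models, AT conjectures and level structures, degenerate intersections, Howard [20, 21],
  `L`-functions implicit in `J`, `∂J_{v₀}` (cf. Section 7 ↦ ★ `R.Sec7LFunctionsRTF.Sec7Data.RSZ2020_7_1_*`, `RSZ2020_7_2_spectral_decomposition`),
  [59]; layout of the paper; acknowledgments) — prose, no mathematical statement; not typed.

### Notation (pp. 5–7)
* «`F` CM, `F₀` totally real of index 2», «`a ↦ ā`», «`F = F₀(√Δ)` for some totally negative `Δ ∈ F₀`», **(1.3)** «`Φ := {φ : F → ℂ ∣ φ(√Δ) ∈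
  ℝ_{>0} √−1}`», «every CM type arises in this way» (p. 5) ↦ ★ `R.Sec3IntegralModels.ShimuraDatum.Δ` ∕ `Δ_totallyNegative` ∕ `sqrtΔ` ∕ `sqrtΔ_sq` ∕
  `Φ` ∕ `mem_Φ_iff` (the datum carries `Φ` with (1.3) as its defining axiom); the weak-approximation remark is context, not typed.
* places `v, v₀` of `F₀`, `w, w₀` of `F`; `F₀,v`, `F_v := F ⊗_{F₀} F₀,v`; `p_v`, `ϖ_v`, `π_v`; `O_{F₀,(v)}`, `O_{F₀,v}`, `O_{F,v}`; `𝔸`, `𝔸_{F₀}`, `𝔸_F`,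
  subscript `f`, superscript `p` (p. 6) ↦ Mathlib `IsDedekindDomain.HeightOneSpectrum (𝓞 F₀)` (`v.asIdeal` = `p_v`), `HeightOneSpectrum.adicCompletion`,
  `(v.adicCompletion F₀) ⊗[F₀] F` (= `F_v`, as in ★ `R.Sec5GlobalIntegralModels.IsNormAt`), `Localization.AtPrime`, `NumberField.AdeleRing`,
  `IsDedekindDomain.FiniteAdeleRing`; places of `F` above `v` ↦ ★ `Literature.NumberTheory.Automorphic.UnitaryGroup.PlacesOver F v`; split ∕
  inert ∕ ramified `v` ↦ ★ `LC.SecC4IntegralModelsUniformization.IsSplit` ∕ `IsInert`, ★ `R.Sec5GlobalIntegralModels.IsRamifiedPlace`; «we often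
  identify the CM type `Φ` with the archimedean places of `F₀`» ↦ ★ `LC.restr F₀ F φ : F₀ →+* ℝ`.
* «hermitian forms linear in the first variable and conjugate-linear in the second … non-degenerate» (p. 6) ↦ ★ `LC.HermSpace` (fields `form_add_left`,
  `form_smul_left`, `form_herm`, `form_nondeg`), in coordinates ★ `R.Sec5GlobalIntegralModels.hermForm`; «`det W ∈ k^×/Nm_{A/k} A^×` … the class of
  `det J`» ↦ ★ `LC.HermSpace.gram` (`.det`), ★ `R.Sec4CitedRows.Sec4Data.detW₀` ∕ `detW₀_eq` (the Gram determinant as an element of `F₀`), the norm class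
  ↦ ★ `R.Sec5GlobalIntegralModels.IsNormAt` ∕ ★ `R.AppASignInvariants.InvIsOne` (`Algebra.norm`); «`−W`» ↦ THIS FILE `negHermSpace` (item 3).
* **(1.4)** «`inv_v(W_v) := (−1)^{n(n−1)/2} det W_v ∈ F₀,v^×/Nm F_v^×`», «`W_v` is split at a finite place `v` if `inv_v(W_v) = 1`; … the antidiagonal
  unit matrix always defines a split hermitian form» (p. 6) ↦ ★ `R.Sec5GlobalIntegralModels.hermIsSplitAt J v` («split» = class trivial, via ★
  `IsNormAt`), ★ `R.AppASignInvariants.InvIsOne` ∕ `AdjustedInvIsOne` (App. A's local form); the `±1` VALUE of the class is the tree's Hilbert symbol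
  `(d, Δ)_v`, `d = (−1)^{n(n−1)/2} det W`: ★ `Q.hilbertSymbol (v.adicCompletion F₀) d Δ` with «`d ∈ Nm F_v^×` iff `(d, Δ)_v = 1`» = ★
  `Q.mk_quadraticNormSubgroup_eq_one_iff_hilbertSymbol` (finite `v`) and ★ `Q.hilbertSymbol_completion_eq_neg_one_iff_neg` (real `v`: the class is
  the sign of `d` at `v`); the antidiagonal remark is context, not typed.
* «`sig_v(W_v) := (r, s)` (the signature)» at archimedean `v` (p. 6) ↦ ★ `LC.HermSpace.sig (τ : F₀ →+* ℝ) : ℕ × ℕ` (`posIndex`, `negIndex`); «`W_φ :=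
  W ⊗_{F,φ} ℂ`» ↦ ★ `LC.HermSpace.gram.map φ` (coordinates, READING R4 of ★ `LC.DefC1toC3`) ∕ `HermSpace.sig (LC.restr F₀ F φ)`.
* «In the local setting, isometry classes of `n`-dimensional `F_v/F₀,v`-hermitian spaces are classified by `inv_v` when `v` is a finite place, and
  by `sig_v` when `v` is an archimedean place» (p. 6) — background sentences without proof or reference in the source: the finite case is
  [Jacobowitz1962, Thm. 3.1] (cited in the tree only in docstrings, e.g. ★ `Literature.NumberTheory.GelbartRogawski1991.ThetaDichotomyVocabulary`; no
  tree declaration states it), the archimedean case is Sylvester's law (★ `Q.Landherr.card_pos_eigenvalues_eq_posCount`, Mathlib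
  `Matrix.IsHermitian.eigenvalues`).  RECORDED, not typed (an INDEX mints no named fact; squad rule R-10).
* «By the Hasse principle, two global hermitian spaces are isometric if and only if they are isometric at every place `v`, i.e. they have the same
  invariants at each finite place and the same signatures at each archimedean place» (p. 6) ↦ ★ THEOREM `Q.Landherr.hermitianMatrices_congruent_iff_
  invariants` (Landherr: congruent iff equal positive indices at all complex embeddings and equal discriminant class in `F₀^×/N(F^×)`; file
  `LandherrHermitianMatrices.lean`), the local-to-global step for the discriminant class = Hasse's norm theorem ★ `Q.hilbertSymbol_eq_one_of_forall_
  completions_holds` (`HasseNormTheoremHolds.lean`), and the ADELIC form ★ `Q.exists_gl_twistGram_eq_of_twistGram_adele`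
  (`HermitianCongruenceOfLocalNorms.lean`).  NOT re-typed.
* **(1.5)** «the product formula for the norm residue symbol for the extension `F/F₀` gives `∏_v inv_v(W_v) = 1`, where `v` ranges through the places
  of `F₀`, and where we identify `F₀,v^×/Nm F_v^× ⊂ {±1}`» (p. 6) ↦ ★ THEOREM `Q.hilbertReciprocity_holds F₀ d Δ` (Hilbert's reciprocity law O'Meara
  71:18, `QuaternionRamificationParityHolds.lean`, for the named statement ★ `Q.hilbertReciprocity`: the places with `(d, Δ)_v = −1` are finite in
  number and even in number counting the real ones), read through the two bridges of the (1.4) row.  NOT re-typed.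
* «Landherr's theorem asserts that a collection `(W_v)_v` of `F_v/F₀,v`-hermitian spaces arises as the set of local completions of a (unique, by the
  Hasse principle) global `F/F₀`-hermitian space exactly when `inv_v(W_v) = 1` for all but finitely many `v` and the product formula (1.5) holds»
  (p. 6) ↦ ★ THEOREMS `Q.exists_prescribed_normClass_sign_iff_even` ∕ `Q.exists_prescribed_normClass_of_finite` (`PrescribedNormClassesCM.lean`: a
  global `d ∈ F₀^×` with prescribed local norm classes and real signs exists iff the parity condition = (1.5)) composed with ★ `Q.Landherr.exists_
  hermitianDiagonal_of_invariants` ∕ `Q.Landherr.hermitianDiagonal_invariants_realised_and_determine` (`LandherrHermitianRealisation.lean`: a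
  hermitian form with prescribed signatures and discriminant exists).  NOT re-typed.
* «`A^∨` the dual abelian scheme»; «`T_p(A)`, `V_p(A)`, `V̂^p(A)`, `T̂(A)`, `V̂(A)`»; «`Hom°(A, A′) := Hom(A, A′) ⊗_ℤ ℚ`» (p. 6) ↦ ★ `AS.AbelianSchemeOver.
  DualPair` ∕ `Polarization` (`AbelianSchemePolarizationBaseChange.lean`); Tate modules have no Mathlib ∕ tree construction for abelian schemes and enter
  the squad files only as ⟨CARRIER⟩s: ★ `KR.Sec2Defs.Sec2Core.TateCoeff` ∕ `tateEmb` ∕ `tateFormWeil` (KR2013 §2), ★ `R.Sec3IntegralModels.M0Clauses` ∕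
  `Sec3Data` clause carriers for `V̂(A₀, A)` of (3.12)–(3.13); `Hom°` likewise (★ `KR.Sec2Defs.Sec2Core.HomOK` is the integral `Hom_{O_k}`).  RECORDED.
* «`M ⊂^r N` … an `R`-submodule of `N` of finite colength `r`. Typically `R` will be `O_{F,v}`» (p. 6) ↦ THIS FILE `IsOfColength` (item 1).
* «`Λ^∨`, the dual lattice with respect to the hermitian form», «the same notation when `Λ` is an `O_{F,v}`-lattice» (pp. 6–7) ↦ THIS FILE `dualLattice`
  (item 2; membership = ★ `R.Sec5GlobalIntegralModels.InDual`); integral self-duality for `k/ℚ` ↦ ★ `KR.Sec2Defs.SelfDualLattice` (KR2013 §2).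
* «vertex lattice of type `r` if `Λ ⊂^r Λ^∨ ⊂ π_v^{-1}Λ`», «self-dual = type 0», «almost self-dual = type 1», «`π_v`-modular if `Λ^∨ = π_v^{-1}Λ`»,
  «almost `π_v`-modular if `Λ ⊂ Λ^∨ ⊂^1 π_v^{-1}Λ`», footnote 5 (comparison with [30] = [KudlaRapoport2011] «vertex lattice of level 0 and type `n − r`»
  and [45] = [RapoportTerstiegeZhang2013]) (p. 7) ↦ OF RECORD for the squad: TKR-t04's ⟨CARRIER⟩ predicates ★ `R.Sec5GlobalIntegralModels.Sec5Data.
  IsVertexTypeAt` ∕ `IsPiModularAt` ∕ `IsAlmostPiModularAt` (at a finite place `v`, for the completion of a global lattice in hermitian coordinates) and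
  ★ `R.Sec4CitedRows.Sec4Data.vertexType`; REAL local cousins elsewhere in the tree: ★ `L.Sec13RelativeFundamentalLemma.IsSelfDualLattice` (self-dual
  `O_E`-lattices over a non-archimedean local field), ★ `L.AppendixA.AFLMinusculeCase…IsVertexLattice` (with the DUAL convention `ϖΛ ⊆ Λ^* ⊆ Λ` of
  [LZ17]/[RTZ13] — exactly the discrepancy footnote 5 describes), ★ `LC.SecC4IntegralModelsUniformization….IsSelfDualFrame` ∕ `latticeOfFrame` (at a
  place `𝔮`, via local frames).  With items 1–2 of this file the printed shape reads, for a lattice over a ring in which «`π_v`» is the ideal `𝔮`: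
  `IsOfColength Λ (dualLattice F₀ F J Λ) r ∧ 𝔮 • dualLattice F₀ F J Λ ≤ Λ` — recorded as the intended reading, NOT declared (no parallel vocabulary
  to the carriers of record).
* «`L̆` the completion of a maximal unramified extension of `L`» (p. 7) — no Mathlib construction; enters ★ `R.Sec4CitedRows` ∕ ★ `R.Sec8…` only inside
  ⟨CARRIER⟩s; «`1_n` the identity matrix» ↦ `(1 : Matrix (Fin n) (Fin n) _)`; «subscript `S` ∕ `A` for base change» ↦ ★ `AS.…baseChange`.  RECORDED.

## DEDUP CENSUS (2026-09-02, squad TKR)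

`rg 'cite: RapoportSmithlingZhang2020Diagonal, §1'` over `lean/Literature` = the Notation tags of ★ `Sec3IntegralModels` ((1.3)), ★ `Sec4CitedRows`
((1.4)), ★ `Sec5GlobalIntegralModels` ((1.4), p. 6–7 lattice words), ★ `AppASignInvariants` ((1.4)) — all cited above; `lean search` ∕ `rg` for
colength ∕ `dualSubmodule` ∕ «hermitian form multiplied by −1»: Mathlib has `LinearMap.BilinForm.dualSubmodule` for BILINEAR forms only (not for a
`conj`-sesquilinear form over `O_F`), no «finite colength» predicate, and ★ `LC.HermSpace` has no sign-twist; nothing in the tree declares items 1–3.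
The short name `dualLattice` also occurs in other namespaces of the tree — ★ `Lan2013.Sec114Pairings.dualLattice` (dual w.r.t. a BILINEAR pairing
`M →ₗ M →ₗ N`, `ModuliOfAbelianVarieties/Lan2013/`), ★ `Literature/Algebra/EuclideanLattices/DualLattice.lean`, ★ `HodgeTheory/IntegralHodgeStructureDual.lean`,
★ `HodgeTheory/ComplexTorusCategoryLatticeDuality.lean`, ★ `ModuliOfAbelianVarieties/SiegelUniversalFamilyTheta.lean` (all `ℤ`-lattices or bilinear) — no FQN
clash, none reusable for a `conj`-sesquilinear form over `O_F` (squad QA T-ref6 N2, 2026-09-02).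

## References

* [RapoportSmithlingZhang2020Diagonal] M. Rapoport, B. Smithling, W. Zhang, *Arithmetic diagonal cycles on unitary Shimura varieties*, Compos.
  Math. 156 (2020) 1745–1824, arXiv:1710.06962v6 — §1 pp. 1–7 as itemised above; §3.2 (3.12), (3.16) pp. 13–15; Conj. 8.13 p. 50, Thm. 8.15 p. 51,
  Thm. 8.19 p. 54, Prop. 8.12 p. 49.
* [Landherr1936HermitianForms] W. Landherr, Abh. Math. Sem. Univ. Hamburg 11 (1936) 245–248 (the tree's `Q.Landherr.*`).
* [Jacobowitz1962] R. Jacobowitz, *Hermitian forms over local fields*, Amer. J. Math. 84 (1962), Thm. 3.1 (local classification; recorded only).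
* [Omeara1963] O. T. O'Meara, *Introduction to quadratic forms* (1963), §63B, §71 Thm. 71:18–71:19 (the tree's `Q.hilbertSymbol`, `Q.hilbertReciprocity`).
-/

noncomputable section

open NumberField IsDedekindDomain
open Literature.NumberTheory.Automorphic.Liu2021.AppendixC (HermSpace conj)

namespace Literature.AlgebraicGeometry.ShimuraVarieties.RapoportSmithlingZhang2020.Sec1Introduction

/-! ## Item 1 — «`M ⊂^r N`» (p. 6) -/

/-- **«`M ⊂^r N`»** (Notation p. 6): «Given modules `M` and `N` over a ring `R`, we write `M ⊂^r N` to indicate that `M` is an `R`-submodule of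
`N` of finite colength `r`. Typically `R` will be `O_{F,v}` for `v` a finite place of `F₀`.»  For two submodules `M, N` of an ambient `R`-module:
`M ≤ N` and the quotient `N / M` (Mathlib `Submodule.submoduleOf`) has length `r` (Mathlib `Module.length`, `ℕ∞`-valued, so «finite» is part of the
equation).  REAL. [cite: RapoportSmithlingZhang2020Diagonal, §1 Notation p. 6] -/
def IsOfColength {R : Type*} [Ring R] {X : Type*} [AddCommGroup X] [Module R X] (M N : Submodule R X) (r : ℕ) : Prop :=
  M ≤ N ∧ Module.length R (↥N ⧸ M.submoduleOf N) = r

/-! ## Item 2 — «`Λ^∨`» as an `O_F`-submodule (pp. 6–7) -/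

variable (F₀ F : Type) [Field F₀] [NumberField F₀] [IsTotallyReal F₀] [Field F] [NumberField F] [Algebra F₀ F]
  [IsTotallyComplex F] [Algebra.IsQuadraticExtension F₀ F]

/-- **«`Λ^∨`, the dual lattice with respect to the hermitian form»** (Notation pp. 6–7: «When `Λ` is an `O_F`-lattice in an `F/F₀`-hermitian space, we
denote the dual lattice with respect to the hermitian form by `Λ^∨`. We use the same notation when `Λ` is an `O_{F,v}`-lattice in an
`F_v/F₀,v`-hermitian space»), for an `O_F`-submodule `Λ` of the coordinate space `κ → F` with Gram matrix `J` (form ★ `Sec5GlobalIntegralModels.hermForm`,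
`F`-linear in the first variable, p. 6): the `O_F`-submodule `{x ∣ (x, y) ∈ O_F for all y ∈ Λ}`.  Its membership predicate is TKR-t04's ★
`Sec5GlobalIntegralModels.InDual F₀ F J Λ x` by `Iff.rfl`; this declaration only supplies the submodule structure (closure under `+`, `0` and the
`O_F`-action, from the linearity of the form in its first variable), so that «`Λ ⊂ Λ^∨`» reads `Λ ≤ dualLattice F₀ F J Λ` and «`Λ ⊂^r Λ^∨`» reads
`IsOfColength Λ (dualLattice F₀ F J Λ) r`.  REAL. [cite: RapoportSmithlingZhang2020Diagonal, §1 Notation pp. 6–7] -/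
def dualLattice {κ : Type} [Fintype κ] (J : Matrix κ κ F) (Λ : Submodule (𝓞 F) (κ → F)) : Submodule (𝓞 F) (κ → F) where
  carrier := {x | Sec5GlobalIntegralModels.InDual F₀ F J Λ x}
  add_mem' := by
    intro x₁ x₂ h₁ h₂ y hy
    obtain ⟨a, ha⟩ := h₁ y hy
    obtain ⟨b, hb⟩ := h₂ y hy
    refine ⟨a + b, ?_⟩
    have hadd : Sec5GlobalIntegralModels.hermForm F₀ F J (x₁ + x₂) y = Sec5GlobalIntegralModels.hermForm F₀ F J x₁ y + Sec5GlobalIntegralModels.hermForm F₀ F J x₂ y := by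
      simp only [Sec5GlobalIntegralModels.hermForm, Pi.add_apply, add_mul, Finset.sum_add_distrib]
    rw [hadd, ha, hb]
    push_cast
    rfl
  zero_mem' := by
    intro y hy
    exact ⟨0, by simp [Sec5GlobalIntegralModels.hermForm]⟩
  smul_mem' := by
    intro c x hx y hy
    obtain ⟨a, ha⟩ := hx y hy
    refine ⟨c * a, ?_⟩
    have hsmul : Sec5GlobalIntegralModels.hermForm F₀ F J (c • x) y = (c : F) * Sec5GlobalIntegralModels.hermForm F₀ F J x y := by
      simp only [Sec5GlobalIntegralModels.hermForm, Pi.smul_apply, Algebra.smul_def, Finset.mul_sum, mul_assoc]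
    rw [hsmul, ha]
    push_cast
    rfl

/-! ## Item 3 — «`−W`» (p. 6) -/

/-- **«`−W`»** (Notation p. 6): «We also write `−W` for the same `A`-module as `W`, but with the hermitian form multiplied by `−1`. Of course `W` and
`−W` have the same unitary groups.»  On ★ `Liu2021.AppendixC.HermSpace F₀ F`: the same underlying space `W.V` and rank `n`, with form
`(x, y) ↦ −(x, y)_W` (again `F`-linear in the first variable, hermitian for ★ `conj F₀ F`, non-degenerate).  This is the `−W` of (3.12) «`η : V̂(A₀, A) ≃
−W ⊗_F 𝔸_{F,f}`» and of «`inv_v(−W_v)`» in (4.4) ∕ (5.3); in Gram-matrix coordinates it is `J ↦ −J`.  REAL.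
[cite: RapoportSmithlingZhang2020Diagonal, §1 Notation p. 6] -/
def negHermSpace (W : HermSpace F₀ F) : HermSpace F₀ F :=
  { W with
    form := fun x y => -W.form x y
    form_add_left := fun x y z => by rw [W.form_add_left, neg_add]
    form_smul_left := fun a x y => by rw [W.form_smul_left, mul_neg]
    form_herm := fun x y => by rw [map_neg, W.form_herm]
    form_nondeg := fun x h => W.form_nondeg x fun y => neg_eq_zero.mp (h y) }

end Literature.AlgebraicGeometry.ShimuraVarieties.RapoportSmithlingZhang2020.Sec1Introduction

end
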